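import Summits.Schanuel.Schanuel.Theorems.RootDecomp1KHyper08

/-!
# RootDecomp1KHyper — part 9 of the «HyperCarving» port wave (lens 6, gen 9 = ROUND 4 of route-Schanuel-RootDecomp1K; 19 parts planned)

Mechanical port (census-1 gen 7, dependency closure; tools census/tools/gen7/portkit2.py + build_l6g9.py) of §17 of HOME/decomp-schanuel-lens-6/g9/HyperCarving.lean
(sha256 aba5c91f…, 8041 l; critic CLEARED FOR TYPING 2026-08-30T13:33:07Z; writer PATH A″ rev 5–8) together with the §§0–16 declarations it depends on
(nothing of the node was in the tree before except RootDecomp1KLinLiouvilleSplit and the Literature fact NesterenkoWaldschmidt1996_thm_5_1).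
This part: node lines 4604–4810 (13 declarations: aeval_A3, natDegree_A3_le, coeff_A3, abs_co3_le, sum_abs_coeff_A3_le, ex3_inj …).
All parts share the namespace `Summit.Schanuel.Schanuel.Theorems.RootDecomp1KHyper` (node sub-namespace `HyperCell` reproduced); statements and proofs
are the node's verbatim; `--supports stmt-Schanuel-33363` (A₄ʰ HyperLiouvilleSchanuel). Sorry-free; standard axioms. Nothing here proves Schanuel; rung 0.
-/

set_option linter.dupNamespace false
set_option linter.unusedSectionVars false

noncomputable section

open Complex IntermediateField Filter Polynomial

namespace Summit.Schanuel.Schanuel.Theorems.RootDecomp1KHyper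

variable {n K : ℕ}

namespace HyperCell

variable {n K : ℕ}

/-- `x · e^{−x} ≤ 1`. -/
private theorem mul_exp_neg_le_one (x : ℝ) : x * Real.exp (-x) ≤ 1 := by
  rw [Real.exp_neg, ← div_eq_mul_inv, div_le_one (Real.exp_pos x)]
  linarith [Real.add_one_le_exp x]

/-- §16f. Level 3 with e^ℓ load-bearing: (ℓ, e, e^ℓ) for hyper-Liouville ℓ > 0: auxiliary statement `aeval_A3` (lens 6 gen 9 node, ported verbatim). -/
theorem aeval_A3 (P : MvPolynomial (Fin 3) ℤ) {D p q : ℕ} (hD : ∀ s ∈ P.support, s 0 ≤ D)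
    (hq : q ≠ 0) (γ : ℂ) :
    aeval γ (A3 P D p q) =
      (q : ℂ) ^ D * MvPolynomial.aeval ![((p : ℂ) / q), γ ^ q, γ ^ p] P := by
  unfold A3
  rw [map_sum, MvPolynomial.aeval_def, MvPolynomial.eval₂_eq', Finset.mul_sum]
  refine Finset.sum_congr rfl fun s hs => ?_
  rw [map_mul, map_pow, aeval_X, aeval_C, Fin.prod_univ_three]
  simp only [algebraMap_int_eq, eq_intCast, Matrix.cons_val_zero, Matrix.cons_val_one,
    Matrix.cons_val]
  have hs0 : s 0 ≤ D := hD s hs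
  have hqC : (q : ℂ) ≠ 0 := by exact_mod_cast hq
  have hsplit : (q : ℂ) ^ D = (q : ℂ) ^ (s 0) * (q : ℂ) ^ (D - s 0) := by
    rw [← pow_add, Nat.add_sub_cancel' hs0]
  simp only [co3, ex3, Int.cast_mul, Int.cast_pow, Int.cast_natCast]
  rw [hsplit, div_pow, pow_add, pow_mul, pow_mul]
  field_simp

/-- §16f. Level 3 with e^ℓ load-bearing: (ℓ, e, e^ℓ) for hyper-Liouville ℓ > 0: auxiliary statement `natDegree_A3_le` (lens 6 gen 9 node, ported verbatim). -/
theorem natDegree_A3_le (P : MvPolynomial (Fin 3) ℤ) (D p q : ℕ) {N : ℕ}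
    (hN : ∀ s ∈ P.support, ex3 q p s ≤ N) : (A3 P D p q).natDegree ≤ N := by
  unfold A3
  refine Polynomial.natDegree_sum_le_of_forall_le _ _ fun s hs => ?_
  exact (Polynomial.natDegree_C_mul_X_pow_le _ _).trans (hN s hs)

/-- §16f. Level 3 with e^ℓ load-bearing: (ℓ, e, e^ℓ) for hyper-Liouville ℓ > 0: auxiliary statement `coeff_A3` (lens 6 gen 9 node, ported verbatim). -/
theorem coeff_A3 (P : MvPolynomial (Fin 3) ℤ) (D p q j : ℕ) :
    (A3 P D p q).coeff j = ∑ s ∈ P.support with ex3 q p s = j, co3 P D p q s := by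
  unfold A3
  rw [finsetSum_coeff, Finset.sum_filter]
  refine Finset.sum_congr rfl fun s _ => ?_
  rw [Polynomial.coeff_C_mul_X_pow]
  by_cases h : ex3 q p s = j
  · rw [if_pos h.symm, if_pos h]
  · rw [if_neg (Ne.symm h), if_neg h]

/-- §16f. Level 3 with e^ℓ load-bearing: (ℓ, e, e^ℓ) for hyper-Liouville ℓ > 0: auxiliary statement `abs_co3_le` (lens 6 gen 9 node, ported verbatim). -/
theorem abs_co3_le (P : MvPolynomial (Fin 3) ℤ) {D p q : ℕ} {s : Fin 3 →₀ ℕ} (hs : s 0 ≤ D) :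
    |co3 P D p q s| ≤ ((p : ℤ) + q) ^ D * |P.coeff s| := by
  unfold co3
  rw [abs_mul, abs_mul, abs_pow, abs_pow, Nat.abs_cast, Nat.abs_cast]
  have h1 : (p : ℤ) ^ (s 0) ≤ ((p : ℤ) + q) ^ (s 0) :=
    pow_le_pow_left₀ (by positivity) (by linarith [(q : ℤ).le_refl, Int.natCast_nonneg q]) _
  have h2 : (q : ℤ) ^ (D - s 0) ≤ ((p : ℤ) + q) ^ (D - s 0) :=
    pow_le_pow_left₀ (by positivity) (by linarith [Int.natCast_nonneg p]) _
  calc |P.coeff s| * (p : ℤ) ^ (s 0) * (q : ℤ) ^ (D - s 0)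
      ≤ |P.coeff s| * ((p : ℤ) + q) ^ (s 0) * ((p : ℤ) + q) ^ (D - s 0) := by
        gcongr
    _ = ((p : ℤ) + q) ^ D * |P.coeff s| := by
        rw [mul_assoc, ← pow_add, Nat.add_sub_cancel' hs]; ring

/-- coefficient mass of `A3`: `Σ_j |a_j| ≤ (p+q)^D · mvlen P` -/
theorem sum_abs_coeff_A3_le (P : MvPolynomial (Fin 3) ℤ) {D p q : ℕ}
    (hD : ∀ s ∈ P.support, s 0 ≤ D) {N : ℕ} (hN : ∀ s ∈ P.support, ex3 q p s ≤ N) :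
    ∑ j ∈ Finset.range (N + 1), |(A3 P D p q).coeff j| ≤ ((p : ℤ) + q) ^ D * mvlen P := by
  calc ∑ j ∈ Finset.range (N + 1), |(A3 P D p q).coeff j|
      ≤ ∑ j ∈ Finset.range (N + 1), ∑ s ∈ P.support with ex3 q p s = j, |co3 P D p q s| :=
        Finset.sum_le_sum fun j _ => by rw [coeff_A3]; exact Finset.abs_sum_le_sum_abs _ _
    _ = ∑ s ∈ P.support, |co3 P D p q s| :=
        Finset.sum_fiberwise_of_maps_to
          (fun s hs => Finset.mem_range.mpr (Nat.lt_succ_of_le (hN s hs))) _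
    _ ≤ ∑ s ∈ P.support, ((p : ℤ) + q) ^ D * |P.coeff s| :=
        Finset.sum_le_sum fun s hs => abs_co3_le P (hD s hs)
    _ = ((p : ℤ) + q) ^ D * mvlen P := by rw [mvlen, Finset.mul_sum]

/-- no collisions: `q b + p c = q b' + p c'` with `c, c' ≤ d < q` and `gcd(p, q) = 1` forces
`(b, c) = (b', c')` -/
theorem ex3_inj {q p d : ℕ} (hpq : Nat.Coprime p q) (hdq : d < q)
    {b c b' c' : ℕ} (hc : c ≤ d) (hc' : c' ≤ d)
    (h : q * b + p * c = q * b' + p * c') : b = b' ∧ c = c' := by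
  have hz : (q : ℤ) * ((b : ℤ) - b') = (p : ℤ) * ((c' : ℤ) - c) := by
    have := congrArg (Nat.cast : ℕ → ℤ) h
    push_cast at this
    linarith
  have hdvd : (q : ℤ) ∣ (p : ℤ) * ((c' : ℤ) - c) := ⟨_, hz.symm⟩
  have hcop : IsCoprime (q : ℤ) (p : ℤ) := Nat.isCoprime_iff_coprime.mpr hpq.symm
  have hdvd' : (q : ℤ) ∣ ((c' : ℤ) - c) := hcop.dvd_of_dvd_mul_left hdvd
  have hcc : ((c' : ℤ) - c) = 0 :=
    Int.eq_zero_of_dvd_of_natAbs_lt_natAbs hdvd' (by omega)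
  have hc_eq : c = c' := by omega
  subst hc_eq
  have hq0 : (q : ℤ) ≠ 0 := by exact_mod_cast (show q ≠ 0 by omega)
  have : ((b : ℤ) - b') = 0 := by
    have h2 : (q : ℤ) * ((b : ℤ) - b') = 0 := by rw [hz]; ring
    exact (mul_eq_zero.mp h2).resolve_left hq0
  exact ⟨by omega, rfl⟩

/-- §16f. Level 3 with e^ℓ load-bearing: (ℓ, e, e^ℓ) for hyper-Liouville ℓ > 0: auxiliary statement `apply_le_totalDegree` (lens 6 gen 9 node, ported verbatim). -/
private theorem apply_le_totalDegree {P : MvPolynomial (Fin 3) ℤ} {s : Fin 3 →₀ ℕ} (hs : s ∈ P.support)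
    (i : Fin 3) : s i ≤ P.totalDegree := by
  refine le_trans ?_ (MvPolynomial.le_totalDegree hs)
  by_cases hi : i ∈ s.support
  · exact Finset.single_le_sum (f := fun j => s j) (fun _ _ => Nat.zero_le _) hi
  · simp [Finsupp.notMem_support_iff.mp hi]

/-- the fibre polynomial `g_{b,c}(X₀) = Σ_a coeff(a,b,c) X₀^a` of a monomial `s⋆ = (·, b, c)` -/
def fib3 (P : MvPolynomial (Fin 3) ℤ) (t : Fin 3 →₀ ℕ) : ℤ[X] :=
  ∑ s ∈ P.support with (s 1 = t 1 ∧ s 2 = t 2), C (P.coeff s) * X ^ (s 0)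

/-- §16f. Level 3 with e^ℓ load-bearing: (ℓ, e, e^ℓ) for hyper-Liouville ℓ > 0: auxiliary statement `fib3_ne_zero` (lens 6 gen 9 node, ported verbatim). -/
theorem fib3_ne_zero (P : MvPolynomial (Fin 3) ℤ) {t : Fin 3 →₀ ℕ} (ht : t ∈ P.support) :
    fib3 P t ≠ 0 := by
  intro h0
  have hc : (fib3 P t).coeff (t 0) = P.coeff t := by
    unfold fib3
    rw [finsetSum_coeff]
    simp only [Polynomial.coeff_C_mul_X_pow]
    rw [Finset.sum_eq_single t]
    · rw [if_pos rfl]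
    · intro s hs hst
      rw [if_neg]
      intro h
      apply hst
      rw [Finset.mem_filter] at hs
      ext i
      fin_cases i
      · exact h.symm
      · exact hs.2.1
      · exact hs.2.2
    · intro h
      exact absurd (Finset.mem_filter.mpr ⟨ht, rfl, rfl⟩) h
  rw [h0, Polynomial.coeff_zero] at hc
  exact (MvPolynomial.mem_support_iff.mp ht) hc.symm

/-- §16f. Level 3 with e^ℓ load-bearing: (ℓ, e, e^ℓ) for hyper-Liouville ℓ > 0: auxiliary statement `aeval_fib3` (lens 6 gen 9 node, ported verbatim). -/
theorem aeval_fib3 (P : MvPolynomial (Fin 3) ℤ) (t : Fin 3 →₀ ℕ) (x : ℂ) :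
    aeval x (fib3 P t) =
      ∑ s ∈ P.support with (s 1 = t 1 ∧ s 2 = t 2), ((P.coeff s : ℤ) : ℂ) * x ^ (s 0) := by
  unfold fib3
  rw [map_sum]
  refine Finset.sum_congr rfl fun s _ => ?_
  rw [map_mul, map_pow, aeval_X, aeval_C, algebraMap_int_eq, eq_intCast]

/-- the `T^{ex3 s⋆}`-coefficient of `A3` is `q^D g_{s⋆}(p/q)` when there are no collisions -/
theorem coeff_A3_ex3_cast (P : MvPolynomial (Fin 3) ℤ) {D p q : ℕ}
    (hD : ∀ s ∈ P.support, s 0 ≤ D) (hq : q ≠ 0) {t : Fin 3 →₀ ℕ}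
    (hinj : ∀ s ∈ P.support, ex3 q p s = ex3 q p t → s 1 = t 1 ∧ s 2 = t 2) :
    (((A3 P D p q).coeff (ex3 q p t) : ℤ) : ℂ) = (q : ℂ) ^ D * aeval ((p : ℂ) / q) (fib3 P t) := by
  rw [coeff_A3, aeval_fib3, Finset.mul_sum]
  have hfilter : (P.support.filter fun s => ex3 q p s = ex3 q p t) =
      P.support.filter fun s => s 1 = t 1 ∧ s 2 = t 2 := by
    refine Finset.filter_congr fun s hs => ⟨hinj s hs, fun h => ?_⟩
    simp only [ex3, h.1, h.2]
  rw [hfilter]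
  push_cast
  refine Finset.sum_congr rfl fun s hs => ?_
  have hs0 : s 0 ≤ D := hD s (Finset.mem_filter.mp hs).1
  have hqC : (q : ℂ) ≠ 0 := by exact_mod_cast hq
  have hsplit : (q : ℂ) ^ D = (q : ℂ) ^ (s 0) * (q : ℂ) ^ (D - s 0) := by
    rw [← pow_add, Nat.add_sub_cancel' hs0]
  simp only [co3, Int.cast_mul, Int.cast_pow, Int.cast_natCast]
  rw [hsplit, div_pow]
  field_simp

/-- **Endgame, level 3**: `δ ≥ exp(−Φ)`, `Φ ≤ c q⁷`, `δ^N ≤ q^D M η`, `N ≤ c_N q`,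
`η < exp(−q^m)`, `q^m ≥ C q⁸` is contradictory. -/
theorem endgame₃ {N D q m : ℕ} {cN c M η δ Φ C : ℝ} (hq : 1 ≤ q) (hc : 0 ≤ c)
    (hM : 0 < M) (hN : (N : ℝ) ≤ cN * q) (hlow : Real.exp (-Φ) ≤ δ)
    (hΦ : Φ ≤ c * (q : ℝ) ^ 7) (hδ : δ ^ N ≤ (q : ℝ) ^ D * M * η)
    (hη : η < Real.exp (-((q : ℝ) ^ m))) (hC : cN * c + D + M + 1 ≤ C)
    (hqm : C * (q : ℝ) ^ 8 ≤ (q : ℝ) ^ m) : False := by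
  have hq1 : (1 : ℝ) ≤ q := by exact_mod_cast hq
  have hE0 : 0 < Real.exp (-Φ) := Real.exp_pos _
  have h1 : Real.exp (-(cN * c * (q : ℝ) ^ 8)) ≤ δ ^ N := by
    have hNΦ : (N : ℝ) * Φ ≤ cN * c * (q : ℝ) ^ 8 := by
      calc (N : ℝ) * Φ ≤ N * (c * (q : ℝ) ^ 7) := mul_le_mul_of_nonneg_left hΦ (Nat.cast_nonneg _)
        _ ≤ (cN * q) * (c * (q : ℝ) ^ 7) := mul_le_mul_of_nonneg_right hN (by positivity)
        _ = cN * c * (q : ℝ) ^ 8 := by ring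
    have hpow : Real.exp (-Φ) ^ N = Real.exp (-((N : ℝ) * Φ)) := by
      rw [← Real.exp_nat_mul]; congr 1; ring
    calc Real.exp (-(cN * c * (q : ℝ) ^ 8)) ≤ Real.exp (-((N : ℝ) * Φ)) :=
          Real.exp_le_exp.mpr (by linarith)
      _ = Real.exp (-Φ) ^ N := hpow.symm
      _ ≤ δ ^ N := pow_le_pow_left₀ hE0.le hlow N
  have h2 : (q : ℝ) ^ D * M * η < Real.exp (-(cN * c * (q : ℝ) ^ 8)) := by
    have hq8 : (q : ℝ) ≤ (q : ℝ) ^ 8 := le_self_pow₀ hq1 (by norm_num)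
    have hq81 : (1 : ℝ) ≤ (q : ℝ) ^ 8 := one_le_pow₀ hq1
    have hD0 : (0 : ℝ) ≤ D := Nat.cast_nonneg _
    have step1 : (q : ℝ) ^ D * M * η < (q : ℝ) ^ D * M * Real.exp (-((q : ℝ) ^ m)) :=
      mul_lt_mul_of_pos_left hη (by positivity)
    have step2 : Real.exp (-((q : ℝ) ^ m)) ≤
        Real.exp (-(cN * c * (q : ℝ) ^ 8)) * (Real.exp (-((D : ℝ) * q)) * Real.exp (-M)) := by
      rw [← Real.exp_add, ← Real.exp_add]
      refine Real.exp_le_exp.mpr ?_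
      have hCq : (cN * c + D + M + 1) * (q : ℝ) ^ 8 ≤ C * (q : ℝ) ^ 8 :=
        mul_le_mul_of_nonneg_right hC (by positivity)
      have hexp : (cN * c + D + M + 1) * (q : ℝ) ^ 8 =
          cN * c * (q : ℝ) ^ 8 + D * (q : ℝ) ^ 8 + M * (q : ℝ) ^ 8 + (q : ℝ) ^ 8 := by ring
      have hDq : (D : ℝ) * q ≤ D * (q : ℝ) ^ 8 := mul_le_mul_of_nonneg_left hq8 hD0
      have hMq : M ≤ M * (q : ℝ) ^ 8 := le_mul_of_one_le_right hM.le hq81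
      linarith
    have hb1 : (q : ℝ) ^ D * Real.exp (-((D : ℝ) * q)) ≤ 1 := by
      have : Real.exp (-((D : ℝ) * q)) = Real.exp (-(q : ℝ)) ^ D := by
        rw [← Real.exp_nat_mul]; congr 1; ring
      rw [this, ← mul_pow]
      exact pow_le_one₀ (by positivity) (mul_exp_neg_le_one _)
    have hb2 : M * Real.exp (-M) ≤ 1 := mul_exp_neg_le_one M
    calc (q : ℝ) ^ D * M * η < (q : ℝ) ^ D * M * Real.exp (-((q : ℝ) ^ m)) := step1
      _ ≤ (q : ℝ) ^ D * M *
          (Real.exp (-(cN * c * (q : ℝ) ^ 8)) * (Real.exp (-((D : ℝ) * q)) * Real.exp (-M))) := by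
          gcongr
      _ = Real.exp (-(cN * c * (q : ℝ) ^ 8)) *
          (((q : ℝ) ^ D * Real.exp (-((D : ℝ) * q))) * (M * Real.exp (-M))) := by ring
      _ ≤ Real.exp (-(cN * c * (q : ℝ) ^ 8)) * (1 * 1) := by gcongr
      _ = Real.exp (-(cN * c * (q : ℝ) ^ 8)) := by ring
  linarith [h1, h2, hδ]

/-- §16f. Level 3 with e^ℓ load-bearing: (ℓ, e, e^ℓ) for hyper-Liouville ℓ > 0: auxiliary statement `HyperLiouville.neg` (lens 6 gen 9 node, ported verbatim). -/
theorem HyperLiouville.neg {ρ : ℝ} (h : HyperLiouville ρ) : HyperLiouville (-ρ) := by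
  intro m
  obtain ⟨r, hden, hne, hlt⟩ := h m
  refine ⟨-r, by rwa [Rat.neg_den], fun h' => hne (by rw [Rat.cast_neg] at h'; linarith), ?_⟩
  rw [Rat.neg_den, Rat.cast_neg, show -ρ - -(r : ℝ) = -(ρ - r) by ring, abs_neg]
  exact hlt

end HyperCell

end Summit.Schanuel.Schanuel.Theorems.RootDecomp1KHyper
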